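import Literature.NumberTheory.Irrationality.Zudilin2002.WellPoisedIntegrals
import Literature.NumberTheory.Transcendental.MultipleZeta
import Literature.NumberTheory.Transcendental.PeriodsWave0
import HarnessLib

/-!
# Coefficients of the linear forms in generalized polylogarithms coming from Sorokin-type integrals (Zlobin 2005)

Topic `Literature/NumberTheory/Irrationality/Zlobin2005`. Typed, cited statements (named facts, no
proofs, D-0014) of S. A. Zlobin, *Properties of coefficients of certain linear forms in generalized
polylogarithms*, Fundam. Prikl. Mat. **11** (2005), no. 6, 41–58 = J. Math. Sci. (N.Y.) **146** (2007),
5655–5668 = arXiv:math/0511245 [Zlobin2005Coefficients]. PRIMARY SOURCE read on the page (held: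
`paper:arxiv-math_0511245`, arXiv text, §§1–3). This is the DENOMINATOR theorem for the generalized
Beukers–Sorokin–Vasilyev multiple integrals with NESTED-PRODUCT denominators
`∏ⱼ (1 − z x₁x₂⋯x_{r_j})^{c_j}` (cell zeta5-irr: zi-p2 `LEMMAS.md` A7 «SorokinLcm … TREE: absent»,
zi-lit `LIT-ZI.md` §7 W2). HONEST FRAMING (inherited from pub-zeta5): systematic search; no irrationality
claim unless certified — nothing in this file concerns the arithmetic nature of any constant.

§1 [cite: Zlobin2005Coefficients, §1]: "Define a generalized polylogarithm by the series
`Le_{s⃗}(z) = Σ_{n₁ ≥ n₂ ≥ ⋯ ≥ n_l ≥ 1} z^{n₁}/(n₁^{s₁} n₂^{s₂} ⋯ n_l^{s_l})` for a vector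
`s⃗ = (s₁,…,s_l)`, `s_j ∈ ℕ`. This series converges when `|z| < 1`. … Let `a_i, b_i, c_j` be integers,
satisfying the certain inequalities. Then, the identity
`S(z) = ∫_{[0,1]^m} ∏_{i=1}^m x_i^{a_i−1}(1−x_i)^{b_i−a_i−1} / ∏_{j=1}^l (1 − z x₁x₂⋯x_{r_j})^{c_j} dx₁⋯dx_m
 = Σ_{s⃗} P_{s⃗}(z⁻¹) Le_{s⃗}(z)`   (1)
holds, where `0 = r₀ < r₁ < r₂ < ⋯ < r_l = m` and `P_{s⃗}` are polynomials with rational coefficients. This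
representation is unique because of the linear independence of `Le_{s⃗}(z)` with different indices over
`ℂ(z)` (see [zl5])." Vasilyev's integrals: "`V_{m,n} = ∫_{[0,1]^m} ∏_{i=1}^m x_iⁿ(1−x_i)ⁿ /
(1 − x₁(1 − x₂(⋯ − x_{m−1}(1 − x_m)⋯)))^{n+1} dx₁⋯dx_m`. He conjectered [sic] that
`V_{2l+1,n} = A₀ + Σ_{j=1}^{l} A_j ζ(2j+1)`, `D_n^{2l+1} A_j ∈ ℤ`   (2)
where `D_n` is the least common multiple of `1, 2, …, n`. … In this paper we prove (2)".

§2 [cite: Zlobin2005Coefficients, §2 Lemma 1]: elementary sums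
`Σ_{n₁ ≥ ⋯ ≥ n_l ≥ 1} z^{n₁−1} ∏_{j=1}^l (n_j+p_j)^{−u_j}` (`p_j ≥ 0`, `u_j ≥ 1`), `w(s⃗) = s₁+⋯+s_l`, "The
height of the polynomial is the maximum of the absolute values of its coefficients. **Lemma 1.** Let
`P = max_{1≤j≤l} p_j`. Then, for the sum (3), the heights of the polynomials `P_{s⃗}` do not exceed
`max(l!·(w(u⃗)2^{w(u⃗)})^{l−1}P^l, 1)`; moreover, `D_P^{w(u⃗)−w(s⃗)} P_{s⃗}(z) ∈ ℤ[z]`."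

§3 [cite: Zlobin2005Coefficients, §3 Theorem 1]: "**Theorem 1.** Let the parameters `a_i, b_i, c_j` be
integers, `b_i > a_i ≥ 1` for `i = 1,…,m` and `c_j ≥ 1`, `c₁ + ⋯ + c_j ≤ q₁ + ⋯ + q_j`, where
`q_j = Σ_{i=r_{j−1}+1}^{r_j} (b_i − a_i)`, `j = 1,…,l`; let `d_j` be nonnegative integers, satisfying
`d_j ≤ c_j` for `j = 1,…,l` and `Σ_{k=j}^{l} d_k < a_i` for `j = 1,…,l` and `r_{j−1} < i ≤ r_j`. Denote
`Δ = max_{1≤j≤l} max_{r_{j−1}<i≤r_j} (b_i − Σ_{k=j}^{l} d_k − 2)`. Assume that the following inequalities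
are valid: `1 ≤ c_j ≤ Δ+1`, `c_{j₁−1} + Σ_{j=j₁}^{j₂} (c_j − q_j) ≤ Δ+1`, `1 < j₁ ≤ j₂ ≤ l`, and that `P_{s⃗}`
are the polynomials from the linear form `S(z) = Σ_{s⃗} P_{s⃗}(z⁻¹) Le_{s⃗}(z)`. Then the polynomial
`D_Δ^{m−w(s⃗)} P_{s⃗}(z)` has integer coefficients." "**Corollary 1.** Let the integral `S(z)` has
parameters `a_i = n+1`, `b_i = 2n+2`, `c_j = n+1`. Then the polynomial `D_n^{m−w(s⃗)} P_{s⃗}(z)` has integer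
coefficients." (take `d_j = 0` for `j < l`, `d_l = n`; then `Δ = n`), followed by the proof of (2) from
Corollary 1 applied to the nested-product form (3) of `V_{2l+1,n}`.

RENDERING (tree vocabulary; no notion re-declared).
* `Le s z` is the printed series for REAL `z` (`s : List ℕ`, chains `n : Fin s.length → ℕ` antitone with
  positive entries = `leIndexSet`; general term `z^{n₁} · Transcendental.mzvTerm s n`, the tree's MZV term),
  with the convention `Le [] z = 1` (PROVED, `Le_nil`) so that the pure-polynomial part of (1) is the
  summand `s⃗ = ∅` (weight `0`; this is how the constant term `U(z⁻¹)` of the proof of (2) and the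
  polynomial parts of the elementary sums carry the full power `D^{m}`, resp. `D_P^{w(u⃗)}`).
  TODO(general form): complex `|z| < 1`.
* The integral `S(z)` is `Params.S` for a parameter record `(l, m, r, a, b, c)` read at the printed
  (1-based) indices; `x₁x₂⋯x_k = headProd x k`; natural-number exponents `a_i − 1`, `b_i − a_i − 1` (the
  printed ones under `b_i > a_i ≥ 1`, which every typed statement assumes); the cube is the closed cube
  (same integral). For `0 < z < 1` the integrand is continuous on the cube, so no junk value occurs.
* "the polynomials from the linear form (1)": an expansion is a finitely supported family
  `coef : List ℕ →₀ ℚ[X]` with `S(z) = Σ_s coef_s(z⁻¹) · Le_s(z)` for all real `0 < z < 1`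
  (`IsLeExpansion`). Theorem 1 / Lemma 1 / Corollary 1 are typed in the form the paper PROVES them:
  THERE IS an expansion whose polynomials have the printed denominators (and heights) — the printed
  wording "the polynomials" additionally uses the uniqueness of (1), which the paper takes from
  [zl5] = [Zlobin2005Expansion] and which is typed separately as `expansion_unique` (its `ℚ[z⁻¹]`-special
  case); `theorem1_forall` then DERIVES the printed "the"-form. "`D^e P(z) ∈ ℤ[z]`" is coefficientwise
  (`HasIntCoeffsMul`); the exponent `m − w(s⃗)` is a natural-number subtraction (in the paper only
  `w(s⃗) ≤ m` occurs; for a hypothetical `w(s⃗) > m` the typed clause asks `P_{s⃗} ∈ ℤ[z]`, which the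
  constructed expansion satisfies vacuously since such `s⃗` do not occur in it).
* Vasilyev's `V_{m,n}` IS the tree's nested-`Q` Sorokin/Vasilyev integral
  `Zudilin2002.sorokinIntegral m (n+1) (n+1,…) (2n+2,…)` (`Q_m(x) = 1 − x₁Q_{m−1}(x₂,…)`, real powers);
  `ζ(2j+1)` is `Transcendental.zetaValue (2j+1)`; `D_n = Nat.lcmUpto n`.
Also typed, because the cell's dictionary needs them and they are printed with these objects:
the nested-product form (3) of `V_{2l+1,n}` [cite: Zlobin2005Coefficients, §1 eq. (3)] (a theorem of
[Zlobin2002Integrals], quoted as (3)), and the integral representation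
`Le_{s⃗}(z) = z ∫_{[0,1]^m} dx/∏_{j}(1 − z x₁⋯x_{r_j})`, `r_j = s₁+⋯+s_j`
[cite: Zlobin2012SpecialValues, §2 Theorem 1] (held: `paper:arxiv-0712.1656` p. 3), i.e. `Le` is the
`a = 1, b = 2, c = 1` member of the family `S`.

NOT here: Lemmas 2–4 (Δ-normal rational functions; the inductive engine), §4 (Lemmas 5–6, Theorem 2:
heights `≤ M^{n+o(n)}` for linearly growing parameters) — see the sibling file if/when typed; the value
`Le_{{2}_k,1}(1) = 2ζ(2k+1)` ([zl4]) used in the last step of the proof of (2).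
-/

noncomputable section

open MeasureTheory Set Finset Polynomial

namespace Literature.NumberTheory.Irrationality.Zlobin2005

open Literature.NumberTheory.Transcendental (mzvTerm zetaValue)

/-! ### Generalized polylogarithms `Le_{s⃗}(z)` -/

/-- Summation domain of `Le_{s⃗}`: NON-increasing chains `n₁ ≥ n₂ ≥ ⋯ ≥ n_k ≥ 1` of positive integers
(`n i = n_{i+1}`; compare the strict chains `Transcendental.mzvIndexSet` of the multiple zeta values).
[cite: Zlobin2005Coefficients, §1 (definition of Le)] -/
def leIndexSet (k : ℕ) : Set (Fin k → ℕ) := {n | Antitone n ∧ ∀ i, 0 < n i}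

/-- The leading index `n₁` of a chain (`0` for the empty chain). [cite: Zlobin2005Coefficients, §1 (definition of Le)] -/
def leadIndex {k : ℕ} (n : Fin k → ℕ) : ℕ := if h : 0 < k then n ⟨0, h⟩ else 0

/-- Zlobin's **generalized polylogarithm** for real `z`:
`Le_{s₁,…,s_l}(z) = Σ_{n₁ ≥ n₂ ≥ ⋯ ≥ n_l ≥ 1} z^{n₁}/(n₁^{s₁}⋯n_l^{s_l})` (a `tsum`, junk `0` if not
summable; the series converges for `|z| < 1`), with the convention `Le_∅(z) = 1` (`Le_nil`).
[cite: Zlobin2005Coefficients, §1 (definition of Le)] -/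
def Le (s : List ℕ) (z : ℝ) : ℝ :=
  ∑' n : leIndexSet s.length, z ^ leadIndex n.1 * mzvTerm s n.1

/-- The empty index: `Le_∅(z) = 1` (the summation domain is the single empty chain, the term is the
empty product) — the constant-term convention under which (1) has the summand `s⃗ = ∅`.
[cite: Zlobin2005Coefficients, §1 (definition of Le; eq. (1), pure polynomial part)] -/
theorem Le_nil (z : ℝ) : Le [] z = 1 := by
  have h0 : (fun _ : Fin ([] : List ℕ).length => (0 : ℕ)) ∈ leIndexSet ([] : List ℕ).length :=
    ⟨fun _ _ _ => le_rfl, fun i => Fin.elim0 i⟩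
  have huniq : ∀ n : leIndexSet ([] : List ℕ).length, n = ⟨fun _ => 0, h0⟩ := by
    intro n
    apply Subtype.ext
    funext i
    exact Fin.elim0 i
  rw [Le, tsum_eq_single ⟨fun _ => 0, h0⟩ (fun n hn => (hn (huniq n)).elim)]
  simp [leadIndex, mzvTerm]

/-! ### The generalized Sorokin integrals `S(z)` -/

/-- Parameters of the integral `S(z)` of (1): the number `l` of denominator factors, the dimension `m`,
the block ends `0 = r₀ < r₁ < ⋯ < r_l = m` (read at `0,…,l`), and the exponents `a_i, b_i` (`i = 1,…,m`),
`c_j` (`j = 1,…,l`), all read at the printed 1-based indices (values elsewhere are ignored).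
[cite: Zlobin2005Coefficients, §1 eq. (1)] -/
structure Params where
  /-- number of denominator factors `l` -/
  l : ℕ
  /-- dimension `m` of the cube -/
  m : ℕ
  /-- block ends `r₀, r₁, …, r_l` -/
  r : ℕ → ℕ
  /-- exponents `a₁, …, a_m` -/
  a : ℕ → ℕ
  /-- exponents `b₁, …, b_m` -/
  b : ℕ → ℕ
  /-- exponents `c₁, …, c_l` -/
  c : ℕ → ℕ

/-- The product of the first `k` variables `x₁x₂⋯x_k` (`x i = x_{i+1}`). [cite: Zlobin2005Coefficients, §1 eq. (1)] -/
def headProd {m : ℕ} (x : Fin m → ℝ) (k : ℕ) : ℝ :=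
  ∏ i ∈ Finset.univ.filter (fun i : Fin m => (i : ℕ) < k), x i

/-- The closed unit cube `[0,1]^m`. [folklore] -/
def cube (m : ℕ) : Set (Fin m → ℝ) := Set.pi Set.univ fun _ : Fin m => Set.Icc (0 : ℝ) 1

namespace Params

/-- `0 = r₀ < r₁ < r₂ < ⋯ < r_l = m` with `l ≥ 1`. [cite: Zlobin2005Coefficients, §1 eq. (1)] -/
def Shape (P : Params) : Prop :=
  1 ≤ P.l ∧ P.r 0 = 0 ∧ P.r P.l = P.m ∧ ∀ j, j < P.l → P.r j < P.r (j + 1)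

/-- The integrand of (1): `∏_{i=1}^m x_i^{a_i−1}(1−x_i)^{b_i−a_i−1} / ∏_{j=1}^l (1 − z x₁x₂⋯x_{r_j})^{c_j}`
(natural-number exponents; the printed ones under `b_i > a_i ≥ 1`). [cite: Zlobin2005Coefficients, §1 eq. (1)] -/
def integrand (P : Params) (z : ℝ) (x : Fin P.m → ℝ) : ℝ :=
  (∏ i : Fin P.m, x i ^ (P.a ((i : ℕ) + 1) - 1) * (1 - x i) ^ (P.b ((i : ℕ) + 1) - P.a ((i : ℕ) + 1) - 1)) /
    ∏ j ∈ Finset.Icc 1 P.l, (1 - z * headProd x (P.r j)) ^ P.c j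

/-- `S(z) = ∫_{[0,1]^m} ∏ x_i^{a_i−1}(1−x_i)^{b_i−a_i−1} / ∏ⱼ (1 − z x₁⋯x_{r_j})^{c_j} dx₁⋯dx_m` (Lebesgue
integral over the closed cube, product measure on `Fin m → ℝ`). [cite: Zlobin2005Coefficients, §1 eq. (1)] -/
def S (P : Params) (z : ℝ) : ℝ := ∫ x in cube P.m, P.integrand z x

/-- `q_j = Σ_{i=r_{j−1}+1}^{r_j} (b_i − a_i)`. [cite: Zlobin2005Coefficients, §3 Theorem 1] -/
def q (P : Params) (j : ℕ) : ℕ := ∑ i ∈ Finset.Ioc (P.r (j - 1)) (P.r j), (P.b i - P.a i)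

/-- `Δ = max_{1≤j≤l} max_{r_{j−1}<i≤r_j} (b_i − Σ_{k=j}^{l} d_k − 2)` for nonnegative integers `d_j`.
[cite: Zlobin2005Coefficients, §3 Theorem 1] -/
def Delta (P : Params) (d : ℕ → ℕ) : ℕ :=
  (Finset.Icc 1 P.l).sup fun j =>
    (Finset.Ioc (P.r (j - 1)) (P.r j)).sup fun i => P.b i - (∑ k ∈ Finset.Icc j P.l, d k) - 2

/-- The hypotheses of Theorem 1 on `(a, b, c)` and the auxiliary nonnegative integers `d₁,…,d_l`:
`b_i > a_i ≥ 1`; `c_j ≥ 1`; `c₁+⋯+c_j ≤ q₁+⋯+q_j`; `d_j ≤ c_j`; `Σ_{k=j}^l d_k < a_i` for `r_{j−1} < i ≤ r_j`;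
`1 ≤ c_j ≤ Δ+1`; `c_{j₁−1} + Σ_{j=j₁}^{j₂}(c_j − q_j) ≤ Δ+1` for `1 < j₁ ≤ j₂ ≤ l` (an inequality of
integers). [cite: Zlobin2005Coefficients, §3 Theorem 1 (hypotheses)] -/
structure Thm1Hyp (P : Params) (d : ℕ → ℕ) : Prop where
  shape : P.Shape
  one_le_a : ∀ i ∈ Finset.Icc 1 P.m, 1 ≤ P.a i
  a_lt_b : ∀ i ∈ Finset.Icc 1 P.m, P.a i < P.b i
  one_le_c : ∀ j ∈ Finset.Icc 1 P.l, 1 ≤ P.c j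
  sum_c_le : ∀ j ∈ Finset.Icc 1 P.l, ∑ k ∈ Finset.Icc 1 j, P.c k ≤ ∑ k ∈ Finset.Icc 1 j, P.q k
  d_le_c : ∀ j ∈ Finset.Icc 1 P.l, d j ≤ P.c j
  sum_d_lt_a : ∀ j ∈ Finset.Icc 1 P.l, ∀ i ∈ Finset.Ioc (P.r (j - 1)) (P.r j),
    ∑ k ∈ Finset.Icc j P.l, d k < P.a i
  c_le_Delta : ∀ j ∈ Finset.Icc 1 P.l, P.c j ≤ P.Delta d + 1
  window : ∀ j₁ j₂ : ℕ, 1 < j₁ → j₁ ≤ j₂ → j₂ ≤ P.l →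
    (P.c (j₁ - 1) : ℤ) + ∑ j ∈ Finset.Icc j₁ j₂, ((P.c j : ℤ) - (P.q j : ℤ)) ≤ (P.Delta d : ℤ) + 1

end Params

/-! ### Expansions in the `Le_{s⃗}` and integrality of their coefficients -/

/-- The sum of an expansion at `z`: `Σ_{s⃗} coef_{s⃗}(z⁻¹) · Le_{s⃗}(z)` for a finitely supported family of
polynomials `coef_{s⃗} ∈ ℚ[X]`. [cite: Zlobin2005Coefficients, §1 eq. (1)] -/
def expansionSum (coef : List ℕ →₀ ℚ[X]) (z : ℝ) : ℝ :=
  coef.sum fun s p => (Polynomial.aeval z⁻¹ p : ℝ) * Le s z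

/-- `coef` is an expansion of `F` of the printed shape (1): finitely many polynomials
`P_{s⃗} = coef s⃗ ∈ ℚ[X]`, indexed by vectors `s⃗` of POSITIVE integers (`s_j ∈ ℕ = {1,2,…}` in the
source; the empty vector carries the pure polynomial part, `Le_∅ = 1`), with
`F(z) = Σ_{s⃗} P_{s⃗}(z⁻¹) · Le_{s⃗}(z)` for all real `0 < z < 1`. (Indices with a zero entry are
excluded as in print — note e.g. `Le_{1,0} = Le_{0} = z/(1−z)`, so uniqueness would fail for them.)
[cite: Zlobin2005Coefficients, §1 eq. (1)] -/
def IsLeExpansion (F : ℝ → ℝ) (coef : List ℕ →₀ ℚ[X]) : Prop :=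
  (∀ s ∈ coef.support, ∀ x ∈ s, 1 ≤ x) ∧ ∀ ⦃z : ℝ⦄, 0 < z → z < 1 → F z = expansionSum coef z

/-- "`N · p(z) ∈ ℤ[z]`", coefficientwise: every coefficient of `p`, multiplied by the rational number `N`,
is an integer. [cite: Zlobin2005Coefficients, §3 (statement shape "`D^e P(z)` has integer coefficients")] -/
def HasIntCoeffsMul (N : ℚ) (p : ℚ[X]) : Prop := ∀ i : ℕ, ∃ k : ℤ, N * p.coeff i = (k : ℚ)

/-- **Uniqueness of the representation (1)** (named fact, statement only; a THEOREM in print): "This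
representation is unique because of the linear independence of `Le_{s⃗}(z)` with different indices over
`ℂ(z)` (see [zl5])" — typed in the kernel form for coefficients in `ℚ[z⁻¹]`, indices of positive integers
(and the empty index for the constant term) and real `0 < z < 1` (a special case of the printed
`ℂ(z)`-linear independence of the functions `1, Le_{s⃗}` on the unit disc, by the identity theorem): an
expansion of the zero function is zero.
[cite: Zlobin2005Coefficients, §1 (sentence after eq. (1))] [cite: Zlobin2005Expansion, main theorem (as reported in Zlobin2005Coefficients §1)] -/
def expansion_unique : Prop :=
  ∀ coef : List ℕ →₀ ℚ[X], (∀ s ∈ coef.support, ∀ x ∈ s, 1 ≤ x) →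
    (∀ ⦃z : ℝ⦄, 0 < z → z < 1 → expansionSum coef z = 0) → coef = 0

/-- Expansion sums are additive in the coefficient family (plumbing for the uniqueness statement).
[cite: Zlobin2005Coefficients, §1 eq. (1)] -/
theorem expansionSum_sub (c c' : List ℕ →₀ ℚ[X]) (z : ℝ) :
    expansionSum (c - c') z = expansionSum c z - expansionSum c' z := by
  unfold expansionSum
  rw [Finsupp.sum_sub_index]
  intro s p₁ p₂
  rw [map_sub, sub_mul]

/-- Under `expansion_unique`, two expansions of the same function coincide ("the polynomials `P_{s⃗}`").
[cite: Zlobin2005Coefficients, §1 (uniqueness of (1))] -/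
theorem IsLeExpansion.unique (hu : expansion_unique) {F : ℝ → ℝ} {c c' : List ℕ →₀ ℚ[X]}
    (hc : IsLeExpansion F c) (hc' : IsLeExpansion F c') : c = c' := by
  have hsupp : ∀ s ∈ (c - c').support, ∀ x ∈ s, 1 ≤ x := by
    intro s hs x hx
    rw [sub_eq_add_neg] at hs
    have hs' := Finsupp.support_add hs
    rw [Finset.mem_union, Finsupp.support_neg] at hs'
    rcases hs' with h | h
    · exact hc.1 s h x hx
    · exact hc'.1 s h x hx
  have h := hu (c - c') hsupp (by
    intro z hz hz1
    have e1 : expansionSum c z = F z := (hc.2 hz hz1).symm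
    have e2 : expansionSum c' z = F z := (hc'.2 hz hz1).symm
    rw [expansionSum_sub, e1, e2, sub_self])
  exact sub_eq_zero.mp h

/-! ### Lemma 1: elementary sums -/

/-- The **elementary sum** `Σ_{n₁ ≥ n₂ ≥ ⋯ ≥ n_l ≥ 1} z^{n₁−1} ∏_{j=1}^l (n_j + p_j)^{−u_j}`
(`p_j ≥ 0`, `u_j ≥ 1`, read at `j = 1,…,l`), real `z` (a `tsum`). [cite: Zlobin2005Coefficients, §2 eq. (3) (definition of elementary sums)] -/
def elementarySum (l : ℕ) (p u : ℕ → ℕ) (z : ℝ) : ℝ :=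
  ∑' n : leIndexSet l,
    z ^ (leadIndex n.1 - 1) * ∏ j : Fin l, (((n.1 j : ℝ) + p ((j : ℕ) + 1)) ^ u ((j : ℕ) + 1))⁻¹

/-- **Zlobin 2005, Lemma 1** (named fact, statement only; a THEOREM in print — the elementary sums expand
in the `Le_{s⃗}` with explicitly bounded heights and denominators `D_P^{w(u⃗)−w(s⃗)}`). For `l ≥ 1`,
`p_j ≥ 0`, `u_j ≥ 1`, `P = max_j p_j`, `w(u⃗) = Σ_j u_j`: the elementary sum has an expansion (1) whose
polynomials `P_{s⃗}` have heights `≤ max(l!·(w(u⃗)2^{w(u⃗)})^{l−1}·P^l, 1)` and satisfy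
`D_P^{w(u⃗)−w(s⃗)} P_{s⃗}(z) ∈ ℤ[z]` (`D_P = lcm(1,…,P) = Nat.lcmUpto P`). Existence form (what the
inductive proof on pp. 2–4 constructs); "the" polynomials by `expansion_unique`.
[cite: Zlobin2005Coefficients, §2 Lemma 1] -/
def lemma1 : Prop :=
  ∀ (l : ℕ) (p u : ℕ → ℕ), 1 ≤ l → (∀ j ∈ Finset.Icc 1 l, 1 ≤ u j) →
    ∃ coef : List ℕ →₀ ℚ[X], IsLeExpansion (elementarySum l p u) coef ∧
      (∀ (s : List ℕ) (i : ℕ), |(coef s).coeff i| ≤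
        max ((l.factorial : ℚ) *
              (((∑ j ∈ Finset.Icc 1 l, u j : ℕ) : ℚ) * 2 ^ (∑ j ∈ Finset.Icc 1 l, u j)) ^ (l - 1) *
              (((Finset.Icc 1 l).sup p : ℕ) : ℚ) ^ l) 1) ∧
      ∀ s : List ℕ, HasIntCoeffsMul
        ((Nat.lcmUpto ((Finset.Icc 1 l).sup p) : ℚ) ^ ((∑ j ∈ Finset.Icc 1 l, u j) - s.sum)) (coef s)

/-! ### Theorem 1 and Corollary 1 -/

/-- **Zlobin 2005, Theorem 1** (named fact, statement only; a THEOREM in print — the denominators of the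
coefficients of the linear forms (1) coming from the generalized Sorokin integrals `S(z)`). Under the
hypotheses `Thm1Hyp P d` (those of Theorem 1, with its auxiliary `d₁,…,d_l` and
`Δ = max_j max_{r_{j−1}<i≤r_j}(b_i − Σ_{k≥j} d_k − 2)`), `S(z)` has an expansion
`S(z) = Σ_{s⃗} P_{s⃗}(z⁻¹) Le_{s⃗}(z)` (`0 < z < 1`) in which `D_Δ^{m−w(s⃗)} P_{s⃗}(z) ∈ ℤ[z]` for every `s⃗`
(`D_Δ = Nat.lcmUpto Δ`, `w(s⃗) = s⃗.sum`). Existence form = what the paper proves (expansion of the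
integrand by `(x₁⋯x_{r_j})^{d_j} = ((1 − (1 − z x₁⋯x_{r_j}))/z)^{d_j}` + Lemma 4); the printed wording "the
polynomials from the linear form" is recovered by `theorem1_forall` under `expansion_unique`.
[cite: Zlobin2005Coefficients, §3 Theorem 1] -/
def theorem1 : Prop :=
  ∀ (P : Params) (d : ℕ → ℕ), P.Thm1Hyp d →
    ∃ coef : List ℕ →₀ ℚ[X], IsLeExpansion P.S coef ∧
      ∀ s : List ℕ, HasIntCoeffsMul ((Nat.lcmUpto (P.Delta d) : ℚ) ^ (P.m - s.sum)) (coef s)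

/-- The printed "the polynomials" form of Theorem 1, DERIVED from the existence form and the uniqueness of
(1): every expansion of `S(z)` has `D_Δ^{m−w(s⃗)} P_{s⃗} ∈ ℤ[z]`.
[cite: Zlobin2005Coefficients, §3 Theorem 1 and §1 (uniqueness of (1))] -/
theorem theorem1_forall (h1 : theorem1) (hu : expansion_unique) (P : Params) (d : ℕ → ℕ)
    (hP : P.Thm1Hyp d) (coef : List ℕ →₀ ℚ[X]) (hcoef : IsLeExpansion P.S coef) (s : List ℕ) :
    HasIntCoeffsMul ((Nat.lcmUpto (P.Delta d) : ℚ) ^ (P.m - s.sum)) (coef s) := by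
  obtain ⟨c, hc, hint⟩ := h1 P d hP
  rw [hcoef.unique hu hc]
  exact hint s

/-- **Zlobin 2005, Corollary 1** (named fact, statement only; a THEOREM in print): for the parameters
`a_i = n+1`, `b_i = 2n+2` (`i = 1,…,m`), `c_j = n+1` (`j = 1,…,l`) and any block structure
`0 = r₀ < ⋯ < r_l = m`, `S(z)` has an expansion (1) with `D_n^{m−w(s⃗)} P_{s⃗}(z) ∈ ℤ[z]` for every `s⃗`
(Theorem 1 with `d_j = 0` for `j < l`, `d_l = n`, `Δ = n`). See `corollary1_of_theorem1` for the derivation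
in the tree. [cite: Zlobin2005Coefficients, §3 Corollary 1] -/
def corollary1 : Prop :=
  ∀ (P : Params) (n : ℕ), P.Shape →
    (∀ i ∈ Finset.Icc 1 P.m, P.a i = n + 1) → (∀ i ∈ Finset.Icc 1 P.m, P.b i = 2 * n + 2) →
    (∀ j ∈ Finset.Icc 1 P.l, P.c j = n + 1) →
    ∃ coef : List ℕ →₀ ℚ[X], IsLeExpansion P.S coef ∧
      ∀ s : List ℕ, HasIntCoeffsMul ((Nat.lcmUpto n : ℚ) ^ (P.m - s.sum)) (coef s)

/-! #### Corollary 1 from Theorem 1 (the printed specialisation, checked in the tree) -/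

namespace Params

/-- Block ends are monotone: `r_i ≤ r_{i+t}` for `i + t ≤ l` (from `0 = r₀ < r₁ < ⋯ < r_l = m`).
[cite: Zlobin2005Coefficients, §1 eq. (1) (block structure)] -/
theorem Shape.le_add {P : Params} (h : P.Shape) (i : ℕ) : ∀ t : ℕ, i + t ≤ P.l → P.r i ≤ P.r (i + t)
  | 0, _ => le_rfl
  | t + 1, ht => by
      have h1 := Shape.le_add h i t (by omega)
      have h2 := h.2.2.2 (i + t) (by omega)
      show P.r i ≤ P.r (i + t + 1)
      omega

/-- Block ends are monotone: `r_i ≤ r_j` for `i ≤ j ≤ l` (from `0 = r₀ < r₁ < ⋯ < r_l = m`).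
[cite: Zlobin2005Coefficients, §1 eq. (1) (block structure)] -/
theorem Shape.mono {P : Params} (h : P.Shape) {i j : ℕ} (hij : i ≤ j) (hj : j ≤ P.l) :
    P.r i ≤ P.r j := by
  obtain ⟨t, rfl⟩ := Nat.exists_eq_add_of_le hij
  exact h.le_add i t hj

/-- Every variable index of the `k`-th block `r_{k−1} < i ≤ r_k` lies in `1,…,m`.
[cite: Zlobin2005Coefficients, §1 eq. (1) (block structure)] -/
theorem Shape.mem_Icc_of_mem_block {P : Params} (h : P.Shape) {k : ℕ} (hk : k ∈ Finset.Icc 1 P.l)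
    {i : ℕ} (hi : i ∈ Finset.Ioc (P.r (k - 1)) (P.r k)) : i ∈ Finset.Icc 1 P.m := by
  rw [Finset.mem_Icc] at hk ⊢
  rw [Finset.mem_Ioc] at hi
  have hkm : P.r k ≤ P.r P.l := h.mono hk.2 le_rfl
  have hm : P.r P.l = P.m := h.2.2.1
  omega

/-- Blocks are nonempty: `r_{k-1} < r_k` for `1 ≤ k ≤ l`.
[cite: Zlobin2005Coefficients, §1 eq. (1) (block structure)] -/
theorem Shape.block_lt {P : Params} (h : P.Shape) {k : ℕ} (hk : k ∈ Finset.Icc 1 P.l) :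
    P.r (k - 1) < P.r k := by
  rw [Finset.mem_Icc] at hk
  have := h.2.2.2 (k - 1) (by omega)
  have hk1 : k - 1 + 1 = k := by omega
  rw [hk1] at this
  exact this

end Params

/-- **Corollary 1 follows from Theorem 1** exactly as printed: take `d_j = 0` for `j < l`, `d_l = n`;
then `Δ = n` and all hypotheses of Theorem 1 hold. [cite: Zlobin2005Coefficients, §3 (proof of Corollary 1)] -/
theorem corollary1_of_theorem1 (h1 : theorem1) : corollary1 := by
  intro P n hP ha hb hc
  -- the auxiliary integers `d`
  set d : ℕ → ℕ := fun j => if j = P.l then n else 0 with hd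
  have hl : 1 ≤ P.l := hP.1
  -- `Σ_{k=j}^{l} d_k = n` for `j ≤ l`
  have hdsum : ∀ j, j ≤ P.l → ∑ k ∈ Finset.Icc j P.l, d k = n := by
    intro j hj
    rw [hd, Finset.sum_ite_eq']
    rw [if_pos (Finset.mem_Icc.mpr ⟨hj, le_rfl⟩)]
  -- `q_k ≥ n + 1` for `1 ≤ k ≤ l`
  have hq : ∀ k ∈ Finset.Icc 1 P.l, n + 1 ≤ P.q k := by
    intro k hk
    have hterm : ∀ i ∈ Finset.Ioc (P.r (k - 1)) (P.r k), P.b i - P.a i = n + 1 := by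
      intro i hi
      have him := hP.mem_Icc_of_mem_block hk hi
      rw [ha i him, hb i him]
      omega
    unfold Params.q
    rw [Finset.sum_const_nat hterm, Nat.card_Ioc]
    have := hP.block_lt hk
    have hcard : 1 ≤ P.r k - P.r (k - 1) := by omega
    calc n + 1 = 1 * (n + 1) := (one_mul _).symm
      _ ≤ (P.r k - P.r (k - 1)) * (n + 1) := Nat.mul_le_mul_right _ hcard
  -- `Δ = n`
  have hDelta : P.Delta d = n := by
    unfold Params.Delta
    rw [Finset.sup_congr rfl (g := fun _ => n)]
    · exact Finset.sup_const (Finset.nonempty_Icc.mpr hl) n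
    · intro j hj
      rw [Finset.sup_congr rfl (g := fun _ => n)]
      · have hlt := hP.block_lt hj
        exact Finset.sup_const (Finset.nonempty_Ioc.mpr hlt) n
      · intro i hi
        have him := hP.mem_Icc_of_mem_block hj hi
        rw [hb i him, hdsum j (Finset.mem_Icc.mp hj).2]
        omega
  have hyp : P.Thm1Hyp d := by
    refine ⟨hP, ?_, ?_, ?_, ?_, ?_, ?_, ?_, ?_⟩
    · intro i hi; rw [ha i hi]; omega
    · intro i hi; rw [ha i hi, hb i hi]; omega
    · intro j hj; rw [hc j hj]; omega
    · intro j hj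
      apply Finset.sum_le_sum
      intro k hk
      have hk' : k ∈ Finset.Icc 1 P.l := by
        rw [Finset.mem_Icc] at hj hk ⊢; omega
      rw [hc k hk']
      exact hq k hk'
    · intro j hj
      rw [hc j hj, hd]
      dsimp only
      split_ifs <;> omega
    · intro j hj i hi
      have him := hP.mem_Icc_of_mem_block hj hi
      rw [ha i him, hdsum j (Finset.mem_Icc.mp hj).2]
      omega
    · intro j hj; rw [hc j hj, hDelta]
    · intro j₁ j₂ hj₁ hj₁₂ hj₂
      have hmem : j₁ - 1 ∈ Finset.Icc 1 P.l := by rw [Finset.mem_Icc]; omega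
      rw [hc (j₁ - 1) hmem, hDelta]
      have hsum : ∑ j ∈ Finset.Icc j₁ j₂, ((P.c j : ℤ) - (P.q j : ℤ)) ≤ 0 := by
        apply Finset.sum_nonpos
        intro j hj
        have hj' : j ∈ Finset.Icc 1 P.l := by
          rw [Finset.mem_Icc] at hj ⊢; omega
        have h1 := hq j hj'
        rw [hc j hj']
        have : ((n + 1 : ℕ) : ℤ) ≤ (P.q j : ℤ) := by exact_mod_cast h1
        push_cast at this ⊢
        linarith
      push_cast
      linarith
  obtain ⟨coef, hcoef, hint⟩ := h1 P d hyp
  refine ⟨coef, hcoef, ?_⟩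
  intro s
  rw [← hDelta]
  exact hint s

/-! ### Vasilyev's integrals and the linear forms (2) -/

/-- **Vasilyev's integral** `V_{m,n} = ∫_{[0,1]^m} ∏ x_iⁿ(1−x_i)ⁿ / (1 − x₁(1 − x₂(⋯(1 − x_m)⋯)))^{n+1} dx`
— the tree's nested-`Q` Sorokin/Vasilyev integral `J_m(n+1; n+1,…,n+1 | 2n+2,…,2n+2)` of
`Zudilin2002/WellPoisedIntegrals.lean` (`Q_m(x₁,…,x_m) = 1 − x₁Q_{m−1}(x₂,…,x_m)`; real powers, which on
the cube are the printed natural powers). [cite: Zlobin2005Coefficients, §1 (definition of V_{m,n})] -/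
def vasilyevIntegral (m n : ℕ) : ℝ :=
  Zudilin2002.sorokinIntegral m ((n : ℝ) + 1) (fun _ => (n : ℝ) + 1) (fun _ => 2 * (n : ℝ) + 2)

/-- **Vasilyev's linear forms (2) — the integrality PROVED by Zlobin 2005** (named fact, statement only;
a THEOREM in print: "As a corollary, we prove (2)"; the integrality `D_n^{2l+1}A_j ∈ ℤ` had been expected
by Vasilyev (2001 preprint) and was proved independently by Krattenthaler–Rivoal, Mem. AMS 186 (2007),
after Zudilin's weaker `D_n^{2l+2}Φ_n^{−1}A_j ∈ ℤ`): for `l ≥ 1` and every `n`,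
`V_{2l+1,n} = A₀ + Σ_{j=1}^{l} A_j ζ(2j+1)` with rational `A_j` such that `D_n^{2l+1} A_j ∈ ℤ`
(`j = 0,…,l`, as the printed proof gives: `A₀ = −U(1)`, `A_k = 2P_k(1)`; `D_n = Nat.lcmUpto n`,
`ζ(k) = Transcendental.zetaValue k`). The case `V_{3,n}` is Beukers' integral for `ζ(3)`. (The printed
proof — Corollary 1 for the form (3), `P₀(1) = 0`, `T_k(1) = 0`, `Le_{{2}_k,1}(1) = 2ζ(2k+1)` — covers
every `n ≥ 0`.)
[cite: Zlobin2005Coefficients, §1 eq. (2) and §3 (proof of (2) after Corollary 1)] -/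
def vasilyev_linearForms : Prop :=
  ∀ l n : ℕ, 1 ≤ l →
    ∃ A : ℕ → ℚ,
      vasilyevIntegral (2 * l + 1) n =
          (A 0 : ℝ) + ∑ j ∈ Finset.Icc 1 l, (A j : ℝ) * zetaValue (2 * j + 1) ∧
        ∀ j, j ≤ l → ∃ k : ℤ, (Nat.lcmUpto n : ℚ) ^ (2 * l + 1) * A j = (k : ℚ)

/-- The parameters of the nested-product form (3) of `V_{2l+1,n}`: `l+1` denominator factors on the
`2l+1` variables with block ends `r_j = 2j` (`j ≤ l`), `r_{l+1} = 2l+1`, and `a_i = n+1`, `b_i = 2n+2`,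
`c_j = n+1`. [cite: Zlobin2005Coefficients, §1 eq. (3)] -/
def vasilyevParams (l n : ℕ) : Params where
  l := l + 1
  m := 2 * l + 1
  r := fun j => if j ≤ l then 2 * j else 2 * l + 1
  a := fun _ => n + 1
  b := fun _ => 2 * n + 2
  c := fun _ => n + 1

/-- The parameters of (3) form a legitimate block structure `0 = r₀ < 2 < 4 < ⋯ < 2l < 2l+1 = m`.
[cite: Zlobin2005Coefficients, §1 eq. (3)] -/
theorem vasilyevParams_shape (l n : ℕ) : (vasilyevParams l n).Shape := by
  refine ⟨by simp [vasilyevParams], by simp [vasilyevParams], by simp [vasilyevParams], ?_⟩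
  intro j hj
  simp only [vasilyevParams] at hj ⊢
  by_cases h1 : j + 1 ≤ l
  · rw [if_pos (by omega), if_pos h1]; omega
  · rw [if_pos (by omega), if_neg h1]; omega

/-- **The nested-product form (3) of Vasilyev's integral** (named fact, statement only; a THEOREM in print,
[Zlobin2002Integrals] as quoted in (3)): for `l ≥ 1`,
`V_{2l+1,n} = ∫_{[0,1]^{2l+1}} ∏ x_iⁿ(1−x_i)ⁿ dx / (∏_{j=1}^{l} (1 − x₁⋯x_{2j})^{n+1} · (1 − x₁x₂⋯x_{2l+1})^{n+1})`,
i.e. `V_{2l+1,n} = S(z = 1)` for `vasilyevParams l n` (the integral (1) at `z = 1`, where it converges).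
[cite: Zlobin2005Coefficients, §1 eq. (3)] [cite: Zlobin2002Integrals, (as reported in Zlobin2005Coefficients eq. (3))] -/
def vasilyevIntegral_eq_nestedProduct : Prop :=
  ∀ l n : ℕ, 1 ≤ l → vasilyevIntegral (2 * l + 1) n = (vasilyevParams l n).S 1

/-! ### `Le_{s⃗}` as a member of the family `S` (Zlobin 2012, Theorem 1) -/

/-- The parameters exhibiting `Le_{s⃗}(z)/z` as an integral (1): `l = l(s⃗)` factors on `m = w(s⃗)`
variables, block ends `r_j = s₁+⋯+s_j`, trivial numerator (`a_i = 1`, `b_i = 2`), simple denominators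
(`c_j = 1`). [cite: Zlobin2012SpecialValues, §2 Theorem 1] -/
def leParams (s : List ℕ) : Params where
  l := s.length
  m := s.sum
  r := fun j => (s.take j).sum
  a := fun _ => 1
  b := fun _ => 2
  c := fun _ => 1

/-- **Zlobin 2012, Theorem 1 (first identity)** (named fact, statement only; a THEOREM in print — "proved by
expanding each fraction `1/(1−t)` into a geometric series and then integrating termwise over a cube (a more
general proposition was proved in [zl5])"): for a nonempty index `s⃗` of positive integers and real
`0 < z < 1`, `Le_{s₁,…,s_l}(z) = z ∫_{[0,1]^m} dx₁⋯dx_m / ∏_{j=1}^l (1 − z x₁x₂⋯x_{r_j})`, `r_j = s₁+⋯+s_j`,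
`m = w(s⃗)`. TODO(general form): `z` in the cut plane `ℂ ∖ [1, ∞)`.
[cite: Zlobin2012SpecialValues, §2 Theorem 1 (arXiv:0712.1656 p. 3)] -/
def le_eq_integral : Prop :=
  ∀ s : List ℕ, s ≠ [] → (∀ x ∈ s, 1 ≤ x) →
    ∀ ⦃z : ℝ⦄, 0 < z → z < 1 → Le s z = z * (leParams s).S z

end Literature.NumberTheory.Irrationality.Zlobin2005
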